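import Mathlib
import Literature.Analysis.FunctionSpaces.Mollification
import Literature.Analysis.FluidPDE.WeakGradientIBP
import HarnessLib

/-!
# Crux `EulerZoomLiouville.PowerGaugeEulerLiouville` (stmt-NavierStokesRegularity-19832), weak stratum, line `weak_axisym` (X1b) /
# `weak_eulerian` (E2): THE MOLLIFIED TRANSPORT EQUATION AND ITS COMMUTATOR

Route №10 `EulerZoomLiouville` (NavierStokesRegularity), crux E = stmt-NavierStokesRegularity-19832; width seat ns-ezl-w1 g9 under the LEAD ns-typeII-p2.
First step of the DiPerna–Lions renormalisation of the damped Casimir law (`stub_etaRenormalisation`, X1b): a scalar `η ∈ L¹_loc` solving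
`div(Wη) = (2γ − 1)η` in `𝒟′(ℝ³)` (`∫ η Dψ[W] = (1 − 2γ)∫ ηψ` for all tests `ψ`) has mollifications `η_φ = φ ⋆ η` (`φ` a test kernel) solving the
equation CLASSICALLY up to the DiPerna–Lions COMMUTATOR

  `r_φ(x) = ∫ η(y) Dφ(x − y)[W(x) − W(y)] dy`:   `D(φ ⋆ η)(x)[W(x)] = r_φ(x) − (1 − 2γ)(φ ⋆ η)(x)`  (every `x`).

* `convolution_lsmul_eq_integral`, `fderiv_convolution_lsmul_apply_eq_integral` — `(φ⋆η)(x) = ∫ φ(x−y)η(y)dy`, `D(φ⋆η)(x)[w] = ∫ Dφ(x−y)[w] η(y) dy`;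
* `integrable_mul_fderiv_comp_sub_apply_const`, `integrable_mul_fderiv_comp_sub_apply` — integrability of the two halves of the commutator;
* `fderiv_convolution_apply_transport_eq` — **the mollified equation with its commutator**.
[folklore; DiPernaLions1989 §II.1 (proof of Thm. II.1, first display); Evans2010 §5.3.1]

WHAT THIS IS NOT: not NS, not E, not the commutator ESTIMATE (DiPerna–Lions Lemma II.1) — only the algebraic identity; 19832 is OPEN.
-/

noncomputable section

-- flat `Theorems/<Route><Decl>…` files of one crux share the namespace of the crux (tree convention)
set_option linter.dupNamespace false

open MeasureTheory Set Filter Topology Metric Function TopologicalSpace ContinuousLinearMap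
open scoped ENNReal NNReal RealInnerProductSpace ContDiff Convolution

namespace Summit.NavierStokesRegularity.NavierStokesRegularity.Theorems.PowerGaugeEulerLiouville.WeakAxisym

open Literature.Analysis Literature.Analysis.FunctionSpaces Literature.Analysis.FluidPDE

section Mollified

variable {W : EuclideanSpace ℝ (Fin 3) → EuclideanSpace ℝ (Fin 3)} {η : EuclideanSpace ℝ (Fin 3) → ℝ}
  {φ : EuclideanSpace ℝ (Fin 3) → ℝ}

/-- `(φ ⋆ η)(x) = ∫ φ(x − y) η(y) dy`. [folklore] -/
theorem convolution_lsmul_eq_integral (x : EuclideanSpace ℝ (Fin 3)) :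
    (φ ⋆[lsmul ℝ ℝ, volume] η) x = ∫ y, φ (x - y) * η y := by
  rw [convolution_def]
  simp only [lsmul_apply, smul_eq_mul]
  rw [← integral_sub_left_eq_self (fun t => φ t * η (x - t)) volume x]
  simp only [sub_sub_cancel]

/-- `D(φ ⋆ η)(x)[w] = ∫ Dφ(x − y)[w] η(y) dy` for a test kernel `φ` and locally integrable `η`. [folklore; Evans2010 §5.3.1] -/
theorem fderiv_convolution_lsmul_apply_eq_integral (hη : LocallyIntegrable η volume)
    (hφ : IsTestFunctionOn (⊤ : Opens (EuclideanSpace ℝ (Fin 3))) φ) (x w : EuclideanSpace ℝ (Fin 3)) :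
    fderiv ℝ (φ ⋆[lsmul ℝ ℝ, volume] η) x w = ∫ y, fderiv ℝ φ (x - y) w * η y := by
  have hφ1 : ContDiff ℝ 1 φ := hφ.contDiff.of_le (by exact_mod_cast le_top)
  have hD := hφ.hasCompactSupport.hasFDerivAt_convolution_left (lsmul ℝ ℝ) hφ1 hη x
  have hint : ConvolutionExistsAt (fderiv ℝ φ) η x
      ((lsmul ℝ ℝ : ℝ →L[ℝ] ℝ →L[ℝ] ℝ).precompL (EuclideanSpace ℝ (Fin 3))) volume :=
    (hφ.hasCompactSupport.fderiv ℝ).convolutionExists_left _ (hφ1.continuous_fderiv one_ne_zero) hη x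
  rw [hD.fderiv, convolution_def, ContinuousLinearMap.integral_apply hint.integrable w]
  simp only [precompL_apply, lsmul_apply, smul_eq_mul]
  rw [← integral_sub_left_eq_self (fun t => fderiv ℝ φ t w * η (x - t)) volume x]
  simp only [sub_sub_cancel]

/-- `y ↦ η(y) · Dφ(x − y)[w]` is integrable (test kernel, locally integrable `η`). [folklore] -/
theorem integrable_mul_fderiv_comp_sub_apply_const (hη : LocallyIntegrable η volume)
    (hφ : IsTestFunctionOn (⊤ : Opens (EuclideanSpace ℝ (Fin 3))) φ) (x w : EuclideanSpace ℝ (Fin 3)) :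
    Integrable (fun y => η y * fderiv ℝ φ (x - y) w) volume := by
  have hψ := hφ.comp_sub_left x
  have hφ1 : ContDiff ℝ 1 φ := hφ.contDiff.of_le (by exact_mod_cast le_top)
  have hc : Continuous fun y => fderiv ℝ (fun z => φ (x - z)) y w :=
    (hψ.contDiff.continuous_fderiv (by simp)).clm_apply continuous_const
  have hs : HasCompactSupport fun y => fderiv ℝ (fun z => φ (x - z)) y w := hψ.hasCompactSupport.fderiv_apply (𝕜 := ℝ) w
  have h := hη.integrable_smul_left_of_hasCompactSupport hc hs
  refine (h.neg).congr (Eventually.of_forall fun y => ?_)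
  simp only [Pi.neg_apply, smul_eq_mul, fderiv_comp_sub_left_apply hφ1]
  ring

/-- `y ↦ η(y) · Dφ(x − y)[W y]` is integrable when `η·‖W‖ ∈ L¹_loc` (test kernel). [folklore] -/
theorem integrable_mul_fderiv_comp_sub_apply (hηm : AEStronglyMeasurable η volume) (hWm : AEStronglyMeasurable W volume)
    (hηW : LocallyIntegrable (fun y => η y * ‖W y‖) volume)
    (hφ : IsTestFunctionOn (⊤ : Opens (EuclideanSpace ℝ (Fin 3))) φ) (x : EuclideanSpace ℝ (Fin 3)) :
    Integrable (fun y => η y * fderiv ℝ φ (x - y) (W y)) volume := by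
  have hψ := hφ.comp_sub_left x
  have hφ1 : ContDiff ℝ 1 φ := hφ.contDiff.of_le (by exact_mod_cast le_top)
  have hDc : Continuous fun y => fderiv ℝ (fun z => φ (x - z)) y := hψ.contDiff.continuous_fderiv (by simp)
  have hDs : HasCompactSupport fun y => fderiv ℝ (fun z => φ (x - z)) y := hψ.hasCompactSupport.fderiv (𝕜 := ℝ)
  have hηWn : LocallyIntegrable (fun y => ‖η y * ‖W y‖‖) volume := fun z => (hηW z).norm
  have hdom := hηWn.integrable_smul_left_of_hasCompactSupport hDc.norm hDs.norm
  have hmeas : AEStronglyMeasurable (fun y => η y * fderiv ℝ φ (x - y) (W y)) volume := by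
    refine hηm.mul ?_
    have hc : Continuous fun y => fderiv ℝ φ (x - y) := (hφ1.continuous_fderiv one_ne_zero).comp (continuous_const.sub continuous_id)
    exact Continuous.comp_aestronglyMeasurable₂ (g := fun (L : EuclideanSpace ℝ (Fin 3) →L[ℝ] ℝ) (v : EuclideanSpace ℝ (Fin 3)) => L v)
      (isBoundedBilinearMap_apply (𝕜 := ℝ) (E := EuclideanSpace ℝ (Fin 3)) (F := ℝ)).continuous hc.aestronglyMeasurable hWm
  refine hdom.mono' hmeas (Eventually.of_forall fun y => ?_)
  rw [norm_mul, smul_eq_mul]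
  have hn : ‖η y * ‖W y‖‖ = ‖η y‖ * ‖W y‖ := by rw [norm_mul, norm_norm]
  rw [hn]
  have h1 : ‖fderiv ℝ φ (x - y) (W y)‖ ≤ ‖fderiv ℝ (fun z => φ (x - z)) y‖ * ‖W y‖ := by
    have e : fderiv ℝ φ (x - y) (W y) = -fderiv ℝ (fun z => φ (x - z)) y (W y) := by
      rw [fderiv_comp_sub_left_apply hφ1, neg_neg]
    rw [e, norm_neg]
    exact (fderiv ℝ (fun z => φ (x - z)) y).le_opNorm _
  calc ‖η y‖ * ‖fderiv ℝ φ (x - y) (W y)‖ ≤ ‖η y‖ * (‖fderiv ℝ (fun z => φ (x - z)) y‖ * ‖W y‖) :=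
        mul_le_mul_of_nonneg_left h1 (norm_nonneg _)
    _ = ‖fderiv ℝ (fun z => φ (x - z)) y‖ * (‖η y‖ * ‖W y‖) := by ring

/-- **THE MOLLIFIED TRANSPORT EQUATION WITH ITS COMMUTATOR.**  If `∫ η Dψ[W] = (1 − 2γ)∫ ηψ` for every test `ψ` (`div(Wη) = (2γ−1)η` in `𝒟′`),
then for every test kernel `φ` and EVERY `x`:
`D(φ ⋆ η)(x)[W x] = (∫ η(y) Dφ(x−y)[W x − W y] dy) − (1 − 2γ)(φ ⋆ η)(x)`
(test the equation with `φ(x − ·)`). [folklore; DiPernaLions1989 §II.1] -/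
theorem fderiv_convolution_apply_transport_eq {γ : ℝ} (hη : LocallyIntegrable η volume) (hWm : AEStronglyMeasurable W volume)
    (hηW : LocallyIntegrable (fun y => η y * ‖W y‖) volume)
    (hφ : IsTestFunctionOn (⊤ : Opens (EuclideanSpace ℝ (Fin 3))) φ)
    (heq : ∀ ψ : EuclideanSpace ℝ (Fin 3) → ℝ, IsTestFunctionOn (⊤ : Opens (EuclideanSpace ℝ (Fin 3))) ψ →
      ∫ y, η y * fderiv ℝ ψ y (W y) = (1 - 2 * γ) * ∫ y, η y * ψ y) (x : EuclideanSpace ℝ (Fin 3)) :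
    fderiv ℝ (φ ⋆[lsmul ℝ ℝ, volume] η) x (W x) =
      (∫ y, η y * fderiv ℝ φ (x - y) (W x - W y)) - (1 - 2 * γ) * (φ ⋆[lsmul ℝ ℝ, volume] η) x := by
  have hφ1 : ContDiff ℝ 1 φ := hφ.contDiff.of_le (by exact_mod_cast le_top)
  -- the equation tested with `φ(x − ·)`
  have h1 : ∫ y, η y * fderiv ℝ φ (x - y) (W y) = -((1 - 2 * γ) * (φ ⋆[lsmul ℝ ℝ, volume] η) x) := by
    have h := heq (fun y => φ (x - y)) (hφ.comp_sub_left x)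
    simp_rw [fderiv_comp_sub_left_apply hφ1, mul_neg, integral_neg] at h
    rw [convolution_lsmul_eq_integral]
    simp_rw [mul_comm (φ (x - _)) (η _)]
    linarith
  -- the `W x` half is the derivative of the mollification
  have h2 : ∫ y, η y * fderiv ℝ φ (x - y) (W x) = fderiv ℝ (φ ⋆[lsmul ℝ ℝ, volume] η) x (W x) := by
    rw [fderiv_convolution_lsmul_apply_eq_integral hη hφ]
    exact integral_congr_ae (Eventually.of_forall fun y => mul_comm _ _)
  have i1 := integrable_mul_fderiv_comp_sub_apply_const hη hφ x (W x)
  have i2 := integrable_mul_fderiv_comp_sub_apply hη.aestronglyMeasurable hWm hηW hφ x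
  have hsplit : ∫ y, η y * fderiv ℝ φ (x - y) (W x - W y) =
      (∫ y, η y * fderiv ℝ φ (x - y) (W x)) - ∫ y, η y * fderiv ℝ φ (x - y) (W y) := by
    rw [← integral_sub i1 i2]
    refine integral_congr_ae (Eventually.of_forall fun y => ?_)
    simp only [map_sub, mul_sub]
  rw [hsplit, h1, h2]
  ring

end Mollified

end Summit.NavierStokesRegularity.NavierStokesRegularity.Theorems.PowerGaugeEulerLiouville.WeakAxisym

end
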